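import Mathlib.LinearAlgebra.Lagrange
import Mathlib.Analysis.SpecialFunctions.Pow.Real
import Literature.NumberTheory.DiophantineGeometry.InterpolationDeterminant

/-!
# Divided differences at integer points: the spacing inequality

SOLOIST deliverable (unit `solo-Parity-informed`, session 15).  The arithmetic half of the
divided-difference (Jarník / Bombieri–Pila) argument, built on the Newton coefficients
`newtonCoeff x f s = f[x_0, …, x_s]` of `Literature…InterpolationDeterminant`:

* `coeff_interpolate_card_sub_one`, `newtonCoeff_eq_sum`: the explicit formula
  `f[x_0..x_s] = ∑_i f(x_i) / ∏_{j ≠ i} (x_i - x_j)`;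
* `one_le_abs_newtonCoeff_mul_pow`: if the nodes `x_0 < ⋯ < x_s` and the values `f(x_i)` are integers and
  `f[x_0..x_s] ≠ 0`, then `1 ≤ |f[x_0..x_s]| · (x_s - x_0)^{s(s+1)}` (clearing the denominator
  `∏_i ∏_{j≠i} (x_i - x_j)`, an integer of modulus `≤ (x_s - x_0)^{s(s+1)}`);
* `one_le_mul_rpow_mul_pow_of_iteratedDeriv`: combined with the mean value theorem for divided
  differences — if `f ∈ C^s` on `(T, ∞)` with `f^{(s)} ≠ 0` and `|f^{(s)}(t)| ≤ M t^e` (`e ≤ 0`) there, then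
  `s + 1` integer points of the graph of `f` with abscissae `≥ y > T` spread over a width `W` with
  `1 ≤ M y^e W^{s(s+1)}`.
-/

namespace Summit.Parity.BatemanHorn.Theorems

open Polynomial Finset
open Literature.NumberTheory.DiophantineGeometry.Dioph

/-- The coefficient of `X^{#s-1}` of the Lagrange interpolant: `∑_i r_i / ∏_{j≠i} (v_i - v_j)`. -/
theorem coeff_interpolate_card_sub_one {ι : Type*} [DecidableEq ι] (s : Finset ι) (v r : ι → ℝ)
    (hvs : Set.InjOn v s) :
    (Lagrange.interpolate s v r).coeff (#s - 1) = ∑ i ∈ s, r i / ∏ j ∈ s.erase i, (v i - v j) := by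
  rw [Lagrange.interpolate_apply, finsetSum_coeff]
  refine sum_congr rfl fun i hi => ?_
  rw [coeff_C_mul, ← Lagrange.natDegree_basis hvs hi, coeff_natDegree, Lagrange.leadingCoeff_basis hvs hi,
    div_eq_mul_inv]

/-- `f[x_0, …, x_s] = ∑_{i ≤ s} f(x_i) / ∏_{j ≤ s, j ≠ i} (x_i - x_j)`. -/
theorem newtonCoeff_eq_sum {x : ℕ → ℝ} (hx : StrictMono x) (f : ℝ → ℝ) (s : ℕ) :
    newtonCoeff x f s
      = ∑ i ∈ range (s + 1), f (x i) / ∏ j ∈ (range (s + 1)).erase i, (x i - x j) := by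
  unfold newtonCoeff interpAt
  have h := coeff_interpolate_card_sub_one (range (s + 1)) x (fun i => f (x i)) hx.injective.injOn
  rw [card_range, Nat.add_sub_cancel] at h
  exact h

/-- **Integrality.**  If the nodes `x_0 < ⋯ < x_s` and the values `f(x_i)` (`i ≤ s`) are integers and
`f[x_0..x_s] ≠ 0`, then `1 ≤ |f[x_0..x_s]| (x_s - x_0)^{s(s+1)}`. -/
theorem one_le_abs_newtonCoeff_mul_pow {x : ℕ → ℝ} (hx : StrictMono x) (f : ℝ → ℝ) (s : ℕ)
    (hxi : ∀ i ≤ s, ∃ z : ℤ, x i = z) (hfi : ∀ i ≤ s, ∃ z : ℤ, f (x i) = z)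
    (hne : newtonCoeff x f s ≠ 0) :
    1 ≤ |newtonCoeff x f s| * (x s - x 0) ^ (s * (s + 1)) := by
  choose! N hN using hxi
  choose! V hV using hfi
  have hmem : ∀ {i}, i ∈ range (s + 1) → i ≤ s := fun hi => Nat.lt_succ_iff.mp (mem_range.mp hi)
  -- the denominators `P i = ∏_{j ≠ i} (x i - x j)` and their product `D`
  set P : ℕ → ℝ := fun i => ∏ j ∈ (range (s + 1)).erase i, (x i - x j) with hP
  have hP0 : ∀ i ∈ range (s + 1), P i ≠ 0 := by
    intro i hi
    rw [hP]
    refine prod_ne_zero_iff.mpr fun j hj => sub_ne_zero.mpr fun h => ?_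
    exact (mem_erase.mp hj).1 (hx.injective h).symm
  set D : ℝ := ∏ i ∈ range (s + 1), P i with hD
  have hD0 : D ≠ 0 := prod_ne_zero_iff.mpr hP0
  -- `newtonCoeff * D` is the integer `E`
  set E : ℤ := ∑ i ∈ range (s + 1), V i * ∏ i' ∈ (range (s + 1)).erase i,
    ∏ j ∈ (range (s + 1)).erase i', (N i' - N j) with hE
  have hPint : ∀ i' ∈ range (s + 1), P i' = ((∏ j ∈ (range (s + 1)).erase i', (N i' - N j) : ℤ) : ℝ) := by
    intro i' hi'
    rw [hP, Int.cast_prod]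
    refine prod_congr rfl fun j hj => ?_
    rw [Int.cast_sub, hN i' (hmem hi'), hN j (hmem (mem_of_mem_erase hj))]
  have hED : newtonCoeff x f s * D = E := by
    rw [newtonCoeff_eq_sum hx f s, sum_mul, hE, Int.cast_sum]
    refine sum_congr rfl fun i hi => ?_
    rw [hD, ← mul_prod_erase _ _ hi,
      show (∏ j ∈ (range (s + 1)).erase i, (x i - x j)) = P i from rfl, ← mul_assoc,
      div_mul_cancel₀ _ (hP0 i hi), Int.cast_mul, hV i (hmem hi), Int.cast_prod]
    congr 1
    exact prod_congr rfl fun i' hi' => hPint i' (mem_of_mem_erase hi')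
  have hE0 : E ≠ 0 := by
    intro h
    rw [h, Int.cast_zero] at hED
    rcases mul_eq_zero.mp hED with h1 | h1
    · exact hne h1
    · exact hD0 h1
  have hE1 : (1 : ℝ) ≤ |(E : ℝ)| := by
    rw [← Int.cast_abs]; exact_mod_cast Int.one_le_abs hE0
  -- `|D| ≤ (x s - x 0)^{s(s+1)}`
  have hW : ∀ i ∈ range (s + 1), ∀ j ∈ range (s + 1), |x i - x j| ≤ x s - x 0 := by
    intro i hi j hj
    have hi0 := hx.monotone (Nat.zero_le i)
    have his := hx.monotone (hmem hi)
    have hj0 := hx.monotone (Nat.zero_le j)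
    have hjs := hx.monotone (hmem hj)
    rw [abs_le]; constructor <;> linarith
  have hDle : |D| ≤ (x s - x 0) ^ (s * (s + 1)) := by
    rw [hD, abs_prod]
    calc ∏ i ∈ range (s + 1), |P i| ≤ ∏ i ∈ range (s + 1), (x s - x 0) ^ s := by
          refine prod_le_prod (fun i _ => abs_nonneg _) fun i hi => ?_
          rw [hP, abs_prod]
          calc ∏ j ∈ (range (s + 1)).erase i, |x i - x j|
              ≤ ∏ j ∈ (range (s + 1)).erase i, (x s - x 0) :=
                prod_le_prod (fun j _ => abs_nonneg _) fun j hj => hW i hi j (mem_of_mem_erase hj)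
            _ = (x s - x 0) ^ s := by rw [prod_const, card_erase_of_mem hi, card_range, Nat.add_sub_cancel]
      _ = (x s - x 0) ^ (s * (s + 1)) := by rw [prod_const, card_range, ← pow_mul]
  calc (1 : ℝ) ≤ |(E : ℝ)| := hE1
    _ = |newtonCoeff x f s| * |D| := by rw [← hED, abs_mul]
    _ ≤ |newtonCoeff x f s| * (x s - x 0) ^ (s * (s + 1)) :=
        mul_le_mul_of_nonneg_left hDle (abs_nonneg _)

/-- **The spacing inequality.**  Let `f ∈ C^s((T, ∞))` with `f^{(s)}(t) ≠ 0` and `|f^{(s)}(t)| ≤ M t^e`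
for `t > T` (`e ≤ 0 ≤ M`).  If `x_0 < ⋯ < x_s` are integers `≥ y > T` (`y > 0`) at which `f` takes integer
values, then `1 ≤ M y^e (x_s - x_0)^{s(s+1)}`. -/
theorem one_le_mul_rpow_mul_pow_of_iteratedDeriv {f : ℝ → ℝ} {T M e : ℝ} {s : ℕ} (he : e ≤ 0)
    (hM : 0 ≤ M) (hf : ContDiffOn ℝ s f (Set.Ioi T))
    (hne : ∀ t, T < t → iteratedDeriv s f t ≠ 0)
    (hbd : ∀ t, T < t → |iteratedDeriv s f t| ≤ M * t ^ e)
    {x : ℕ → ℝ} (hx : StrictMono x) (hxi : ∀ i ≤ s, ∃ z : ℤ, x i = z)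
    (hfi : ∀ i ≤ s, ∃ z : ℤ, f (x i) = z) {y : ℝ} (hy : 0 < y) (hTy : T < y) (hyx : y ≤ x 0) :
    1 ≤ M * y ^ e * (x s - x 0) ^ (s * (s + 1)) := by
  have hsub : Set.Icc (x 0) (x s) ⊆ Set.Ioi T := fun u hu => lt_of_lt_of_le (hTy.trans_le hyx) hu.1
  obtain ⟨ξ, hξ, hξeq⟩ := exists_newtonCoeff_eq f hx isOpen_Ioi s hf hsub
  have hξT : T < ξ := hsub hξ
  have hyξ : y ≤ ξ := hyx.trans hξ.1
  have hnc : newtonCoeff x f s ≠ 0 := by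
    intro h0
    exact hne ξ hξT (by rw [hξeq, h0, mul_zero])
  have h1 := one_le_abs_newtonCoeff_mul_pow hx f s hxi hfi hnc
  -- `|f[x_0..x_s]| ≤ |f^{(s)}(ξ)| ≤ M ξ^e ≤ M y^e`
  have h2 : |newtonCoeff x f s| ≤ M * y ^ e := by
    have hfac : (1 : ℝ) ≤ (s.factorial : ℝ) := by exact_mod_cast Nat.one_le_iff_ne_zero.mpr (Nat.factorial_ne_zero s)
    calc |newtonCoeff x f s| ≤ (s.factorial : ℝ) * |newtonCoeff x f s| :=
          le_mul_of_one_le_left (abs_nonneg _) hfac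
      _ = |iteratedDeriv s f ξ| := by rw [hξeq, abs_mul, Nat.abs_cast]
      _ ≤ M * ξ ^ e := hbd ξ hξT
      _ ≤ M * y ^ e := mul_le_mul_of_nonneg_left (Real.rpow_le_rpow_of_nonpos hy hyξ he) hM
  have hW : 0 ≤ (x s - x 0) ^ (s * (s + 1)) := pow_nonneg (sub_nonneg.mpr (hx.monotone (Nat.zero_le s))) _
  exact h1.trans (mul_le_mul_of_nonneg_right h2 hW)

end Summit.Parity.BatemanHorn.Theorems
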